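import Summits.HodgeConjecture.CorCM.MumfordTateRankFiveHodge
import Summits.HodgeConjecture.CorCM.MumfordTateRankOfCMAbelianVariety
import Summits.HodgeConjecture.CorCM.CMAbelianVarietyDimLeThreePowers
import Literature.AlgebraicGeometry.HodgeTheory.Sl2IsotypicTimesCMDivisorClasses
import HarnessLib

/-!
# `A × C` is stably nondegenerate for `A` non-CM of Hodge-group rank three (non-CM elliptic curves, QM abelian surfaces) and
# `C` a stably nondegenerate abelian variety of CM type (every CM abelian variety of dimension `≤ 3`; maximal Mumford–Tate rank):
# `B = D` and the Hodge conjecture for all powers of `A × C`, unconditionally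

COR-CM (cell `pub-hodgecm2`, seat `b27` gen 35, count-neutral lane MT-RANK-FIVE-DIVISORS, file F5; theorems only, no
definition, no named fact; UNCONDITIONAL — nothing here uses or asserts HC_CM).  Moonen–Zarhin 1999 Thm. (3.2)(2) («`X₁` no
factor of Type 4, `X₂` of CM-type, both satisfying (D) ⟹ `X₁ × X₂` satisfies (D)») was PROVED for the `𝔰𝔩₂`-isotypic class in
`HodgeTheory/Sl2IsotypicTimesCMDivisorClasses` (`isStablyNondegenerate_prod_of_finrank_hodgeLie_le_three_of_isOfCMType`, with
condition (D) for the CM factor as hypothesis).  This file discharges that hypothesis on the two classes of CM abelian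
varieties for which the tree PROVES condition (D):

* §1 `C` of CM type with `dim C ≤ 3` (`isDivisorGenerated_powSucc_of_isOfCMType_of_dim_le_three`, `CorCM/CMAbelianVarietyDimLeThreePowers`:
  CM elliptic curves, CM surfaces, CM threefolds simple or not, and their powers):
  **`isStablyNondegenerate_prod_of_finrank_hodgeLie_le_three_of_isOfCMType_of_dim_le_three`**; `C` of CM type with
  Mumford–Tate group of the maximal dimension `dim C + 1`
  (`forall_isDivisorGenerated_powSucc_of_mtRank_hodge_one_eq_dim_add_one`, `CorCM/MumfordTateRankOfCMAbelianVariety`):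
  **`isStablyNondegenerate_prod_of_finrank_hodgeLie_le_three_of_mtRank_hodge_one_eq_dim_add_one`**; hence `B = D` and the
  Hodge conjecture for everything dominated by a power of `A × C` (`…_of_avDominatedBy_powSucc_prod_…`).
* §2 the factor `A` made explicit: `A = P` simple, NOT of CM type, `dim_ℚ End⁰(P) = (dim P)²`, `dim P ≤ 2` (a non-CM elliptic
  curve or an abelian surface with quaternionic multiplication; `not_le_endAlg_and_finrank_hodgeLie_le_three_of_factor`), and
  `A = B` ANY elliptic curve not of CM type: **`isStablyNondegenerate_prod_of_not_isOfCMType_of_dim_one_of_isOfCMType_of_dim_le_three`**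
  — e.g. `B × T` with `T` a CM threefold, `S × T` with `S` a QM surface: all powers have `B = D` and satisfy HC.

These products have Mumford–Tate rank up to `4 + 3 = 7` (beyond the ladder files `CorCM/MumfordTateRankFive*`); the point is
Moonen–Zarhin's mechanism (3.2)(2), now a theorem of the tree on this class.

## References
* [MoonenZarhin1999LowDim] B. Moonen, Yu. Zarhin, Math. Ann. 315 (1999) 711–733, §2 (2.1)–(2.5), §3 Thm. (3.2)(2), (3.8)–(3.9),
  §5 (5.2) [corpus: paper:arxiv-math_9901113 p. 4–6].
* [Gordon1999HodgeAVSurvey] B. B. Gordon, *A survey of the Hodge conjecture for abelian varieties*, Thm. 7.5, Def. 7.6,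
  Thm. 7.6.2, 7.7, §7.3.2.
* [Hazama1989] F. Hazama, Duke Math. J. 58 (1989) 31–37.
* [vanGeemen1994HodgeAV] B. van Geemen, LNM 1594 (1994), §2.4–2.5, Lemma 3.7, Thm. 4.3.
* [MumfordAV1970] D. Mumford, *Abelian Varieties* (1970), §19 Thm. 1, Cor. 2 and p. 174.
-/

noncomputable section

open CategoryTheory CategoryTheory.Limits Module
open scoped BigOperators

namespace Summit.HodgeConjecture.CorCM

open Literature.AlgebraicGeometry.Motives
open Literature.AlgebraicGeometry.Motives.AbelianVariety
open Literature.AlgebraicGeometry.Motives.HodgeStructure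
open Literature.AlgebraicGeometry.HodgeTheory
open Literature.AlgebraicGeometry.Milne1999 (IsOfCMType)
open Summit.HodgeConjecture.CorCM.Domination

variable [HodgeTensorFacts.{0, 0}]

/-! ## §1 `A × C` with `C` of CM type of dimension `≤ 3`, or of maximal Mumford–Tate rank -/

section CMFactor

variable {A C : AbelianVariety ℂ} {k : ℕ}

/-- **Moonen–Zarhin Thm. (3.2)(2), unconditional instance: `A × C` is stably nondegenerate** for `A` NOT of CM type with
`dim_ℚ Lie Hg(H¹A) ≤ 3` and `C` of CM type with `dim C ≤ 3` — every CM abelian variety of dimension `≤ 3` satisfies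
condition (D) (`isDivisorGenerated_powSucc_of_isOfCMType_of_dim_le_three`: Moonen–Zarhin (5.2), Pohlmann/imaginary-quadratic
regrouping), so §3 of `Sl2IsotypicTimesCMDivisorClasses` applies. [cite: MoonenZarhin1999LowDim, §3 Thm. (3.2)(2) and §5 (5.2)]
[cite: Gordon1999HodgeAVSurvey, Thm. 7.5, Def. 7.6 and Thm. 7.6.2] -/
theorem isStablyNondegenerate_prod_of_finrank_hodgeLie_le_three_of_isOfCMType_of_dim_le_three
    (hne : haveI := BettiUniverse.finite (AbelianVariety.isSmoothProjective_holds (A := A)) 1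
      ¬ (BettiUniverse.hodge exists_isReal_hodgeModel_holds (AbelianVariety.isSmoothProjective_holds (A := A)) 1).hodgeLie
        ≤ Subalgebra.toSubmodule
          (BettiUniverse.hodge exists_isReal_hodgeModel_holds (AbelianVariety.isSmoothProjective_holds (A := A)) 1).endAlg)
    (h3 : haveI := BettiUniverse.finite (AbelianVariety.isSmoothProjective_holds (A := A)) 1
      Module.finrank ℚ (BettiUniverse.hodge exists_isReal_hodgeModel_holds
        (AbelianVariety.isSmoothProjective_holds (A := A)) 1).hodgeLie ≤ 3)
    (hC : IsOfCMType C) (hC3 : C.dim ≤ 3) : IsStablyNondegenerate (A.prod C) :=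
  isStablyNondegenerate_prod_of_finrank_hodgeLie_le_three_of_isOfCMType hne h3 hC fun N =>
    isDivisorGenerated_powSucc_of_isOfCMType_of_dim_le_three hC hC3 N

/-- **… and all mixed powers `A^{M+1} × C^{N+1}` are stably nondegenerate** (`C` of CM type, `dim C ≤ 3`).
[cite: MoonenZarhin1999LowDim, §3 Thm. (3.2)(2) and §5 (5.2)] [cite: Gordon1999HodgeAVSurvey, Def. 7.6 and Thm. 7.6.2] -/
theorem isStablyNondegenerate_powSucc_prod_powSucc_of_finrank_hodgeLie_le_three_of_isOfCMType_of_dim_le_three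
    (hne : haveI := BettiUniverse.finite (AbelianVariety.isSmoothProjective_holds (A := A)) 1
      ¬ (BettiUniverse.hodge exists_isReal_hodgeModel_holds (AbelianVariety.isSmoothProjective_holds (A := A)) 1).hodgeLie
        ≤ Subalgebra.toSubmodule
          (BettiUniverse.hodge exists_isReal_hodgeModel_holds (AbelianVariety.isSmoothProjective_holds (A := A)) 1).endAlg)
    (h3 : haveI := BettiUniverse.finite (AbelianVariety.isSmoothProjective_holds (A := A)) 1
      Module.finrank ℚ (BettiUniverse.hodge exists_isReal_hodgeModel_holds
        (AbelianVariety.isSmoothProjective_holds (A := A)) 1).hodgeLie ≤ 3)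
    (hC : IsOfCMType C) (hC3 : C.dim ≤ 3) (M N : ℕ) : IsStablyNondegenerate ((A.powSucc M).prod (C.powSucc N)) :=
  (isStablyNondegenerate_prod_of_finrank_hodgeLie_le_three_of_isOfCMType_of_dim_le_three hne h3 hC hC3).powSucc_prod_powSucc M N

/-- **`A × C` is stably nondegenerate for `C` of CM type with Mumford–Tate group of the MAXIMAL dimension `dim C + 1`**
(`C` is then stably nondegenerate, `forall_isDivisorGenerated_powSucc_of_mtRank_hodge_one_eq_dim_add_one`; e.g. products of
pairwise non-isogenous CM elliptic curves, simple CM abelian varieties of prime dimension, generic CM types).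
[cite: MoonenZarhin1999LowDim, §3 Thm. (3.2)(2)] [cite: Gordon1999HodgeAVSurvey, Thm. 7.5, 7.7 and Thm. 7.6.2] -/
theorem isStablyNondegenerate_prod_of_finrank_hodgeLie_le_three_of_mtRank_hodge_one_eq_dim_add_one
    (hne : haveI := BettiUniverse.finite (AbelianVariety.isSmoothProjective_holds (A := A)) 1
      ¬ (BettiUniverse.hodge exists_isReal_hodgeModel_holds (AbelianVariety.isSmoothProjective_holds (A := A)) 1).hodgeLie
        ≤ Subalgebra.toSubmodule
          (BettiUniverse.hodge exists_isReal_hodgeModel_holds (AbelianVariety.isSmoothProjective_holds (A := A)) 1).endAlg)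
    (h3 : haveI := BettiUniverse.finite (AbelianVariety.isSmoothProjective_holds (A := A)) 1
      Module.finrank ℚ (BettiUniverse.hodge exists_isReal_hodgeModel_holds
        (AbelianVariety.isSmoothProjective_holds (A := A)) 1).hodgeLie ≤ 3)
    (hCsp : IsSmoothProjective k C.X) (h0 : 0 < C.dim) (hC : IsOfCMType C)
    (hmt : haveI := BettiUniverse.finite hCsp 1
      (BettiUniverse.hodge exists_isReal_hodgeModel_holds hCsp 1).mtRank = C.dim + 1) :
    IsStablyNondegenerate (A.prod C) :=
  isStablyNondegenerate_prod_of_finrank_hodgeLie_le_three_of_isOfCMType hne h3 hC fun N =>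
    forall_isDivisorGenerated_powSucc_of_mtRank_hodge_one_eq_dim_add_one hCsp h0 hC hmt N

/-- **`B = D` and the Hodge conjecture for everything dominated by a power of `A × C`** (`C` of CM type, `dim C ≤ 3`):
abelian subvarieties, quotients and isogeny factors of the `(A × C)^{N+1}`, UNCONDITIONALLY.
[cite: MoonenZarhin1999LowDim, §2 condition (D), §3 Thm. (3.2)(2) and §5 (5.2)] [cite: vanGeemen1994HodgeAV, §2.4–2.5 and §3.6–3.7] -/
theorem isDivisorGenerated_and_hodgeConjectureFor_of_avDominatedBy_powSucc_prod_of_isOfCMType_of_dim_le_three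
    (hne : haveI := BettiUniverse.finite (AbelianVariety.isSmoothProjective_holds (A := A)) 1
      ¬ (BettiUniverse.hodge exists_isReal_hodgeModel_holds (AbelianVariety.isSmoothProjective_holds (A := A)) 1).hodgeLie
        ≤ Subalgebra.toSubmodule
          (BettiUniverse.hodge exists_isReal_hodgeModel_holds (AbelianVariety.isSmoothProjective_holds (A := A)) 1).endAlg)
    (h3 : haveI := BettiUniverse.finite (AbelianVariety.isSmoothProjective_holds (A := A)) 1
      Module.finrank ℚ (BettiUniverse.hodge exists_isReal_hodgeModel_holds
        (AbelianVariety.isSmoothProjective_holds (A := A)) 1).hodgeLie ≤ 3)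
    (hC : IsOfCMType C) (hC3 : C.dim ≤ 3) {Y : AbelianVariety ℂ} {N : ℕ} (hY : AVDominatedBy Y ((A.prod C).powSucc N)) :
    IsDivisorGenerated Y ∧ HodgeConjectureFor Y.dim Y.X :=
  have hD := isDivisorGenerated_of_avDominatedBy hY
    (isStablyNondegenerate_prod_of_finrank_hodgeLie_le_three_of_isOfCMType_of_dim_le_three hne h3 hC hC3 N)
  ⟨hD, hodgeConjectureFor_of_isDivisorGenerated Y hD⟩

end CMFactor

/-! ## §2 The non-CM factor made explicit: non-CM elliptic curves and QM abelian surfaces -/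

section Explicit

variable {P B C : AbelianVariety ℂ}

/-- **`P × C` is stably nondegenerate** for `P` SIMPLE, NOT of CM type, with `dim_ℚ End⁰(P) = (dim P)²` and `0 < dim P ≤ 2`
(a non-CM elliptic curve, `End⁰ = ℚ`, or an abelian surface with quaternionic multiplication — the simple factors of the rungs
`dim MT(H¹X) ∈ {4, 5}`; `not_le_endAlg_and_finrank_hodgeLie_le_three_of_factor`) and `C` of CM type with `dim C ≤ 3`:
`B•((P × C)^{N+1}) = D•((P × C)^{N+1}) ⊗ ℂ` for all `N`, UNCONDITIONALLY (e.g. QM surface × CM threefold, QM surface × CM surface).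
[cite: MoonenZarhin1999LowDim, §2 (2.1)–(2.2), §3 Thm. (3.2)(2) and §5 (5.2)] [cite: Gordon1999HodgeAVSurvey, Thm. 7.5 and §7.3.2] -/
theorem isStablyNondegenerate_prod_of_factor_of_isOfCMType_of_dim_le_three (hS : P.IsSimple) (h0 : 0 < P.dim)
    (hcm : ¬ IsOfCMType P) (hd : Module.finrank ℚ P.endAlgebra = P.dim ^ 2) (h2 : P.dim ≤ 2)
    (hC : IsOfCMType C) (hC3 : C.dim ≤ 3) : IsStablyNondegenerate (P.prod C) := by
  obtain ⟨hne, h3⟩ := not_le_endAlg_and_finrank_hodgeLie_le_three_of_factor hS h0 hcm hd h2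
  exact isStablyNondegenerate_prod_of_finrank_hodgeLie_le_three_of_isOfCMType_of_dim_le_three hne h3 hC hC3

/-- **`B × C` is stably nondegenerate for EVERY elliptic curve `B` NOT of CM type and every `C` of CM type with
`dim C ≤ 3`**: all powers `(B × C)^{N+1}` have `B = D`, UNCONDITIONALLY (`B` is simple with `End⁰(B) = ℚ`,
`finrank_endAlgebra_eq_one_of_dim_one`; e.g. `B × T`, `T` a CM threefold, or `B × E₁ × E₂ × E₃` regrouped).
[cite: MoonenZarhin1999LowDim, §2 (2.1), §3 Thm. (3.2)(2), (3.8)–(3.9) and §5 (5.2)] [cite: Gordon1999HodgeAVSurvey, Thm. 7.5 and Thm. 7.6.2] -/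
theorem isStablyNondegenerate_prod_of_not_isOfCMType_of_dim_one_of_isOfCMType_of_dim_le_three (hB1 : B.dim = 1)
    (hBcm : ¬ IsOfCMType B) (hC : IsOfCMType C) (hC3 : C.dim ≤ 3) : IsStablyNondegenerate (B.prod C) :=
  isStablyNondegenerate_prod_of_factor_of_isOfCMType_of_dim_le_three (isSimple_of_dim_le_one hB1.le) (by omega) hBcm
    (by rw [finrank_endAlgebra_eq_one_of_dim_one (AbelianVariety.isSmoothProjective_holds (A := B)) hB1 hBcm, hB1]; rfl)
    (by omega) hC hC3

/-- **The Hodge conjecture for every power of `P × C` and everything dominated by one** (`P` a non-CM elliptic curve or a QM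
abelian surface as above, `C` of CM type with `dim C ≤ 3`), UNCONDITIONALLY. [cite: MoonenZarhin1999LowDim, §2 condition (D) and §3 Thm. (3.2)(2)]
[cite: vanGeemen1994HodgeAV, §2.4–2.5 and §3.6–3.7] -/
theorem isDivisorGenerated_and_hodgeConjectureFor_of_avDominatedBy_powSucc_prod_of_factor (hS : P.IsSimple)
    (h0 : 0 < P.dim) (hcm : ¬ IsOfCMType P) (hd : Module.finrank ℚ P.endAlgebra = P.dim ^ 2) (h2 : P.dim ≤ 2)
    (hC : IsOfCMType C) (hC3 : C.dim ≤ 3) {Y : AbelianVariety ℂ} {N : ℕ} (hY : AVDominatedBy Y ((P.prod C).powSucc N)) :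
    IsDivisorGenerated Y ∧ HodgeConjectureFor Y.dim Y.X :=
  have hD := isDivisorGenerated_of_avDominatedBy hY
    (isStablyNondegenerate_prod_of_factor_of_isOfCMType_of_dim_le_three hS h0 hcm hd h2 hC hC3 N)
  ⟨hD, hodgeConjectureFor_of_isDivisorGenerated Y hD⟩

/-- **The Hodge conjecture for every power `(B × C)^{N+1}`**, `B` an elliptic curve NOT of CM type, `C` of CM type with
`dim C ≤ 3`, UNCONDITIONALLY. [cite: MoonenZarhin1999LowDim, §2 condition (D) and §3 Thm. (3.2)(2)] [cite: vanGeemen1994HodgeAV, §2.4] -/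
theorem hodgeConjectureFor_powSucc_prod_of_not_isOfCMType_of_dim_one_of_isOfCMType_of_dim_le_three (hB1 : B.dim = 1)
    (hBcm : ¬ IsOfCMType B) (hC : IsOfCMType C) (hC3 : C.dim ≤ 3) (N : ℕ) :
    HodgeConjectureFor ((B.prod C).powSucc N).dim ((B.prod C).powSucc N).X :=
  (isStablyNondegenerate_prod_of_not_isOfCMType_of_dim_one_of_isOfCMType_of_dim_le_three hB1 hBcm hC hC3).hodgeConjectureFor_powSucc
    N

end Explicit

end Summit.HodgeConjecture.CorCM

end
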